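import Summits.BirchSwinnertonDyer.BirchSwinnertonDyer.Theorems.CMKolyvaginAtInertTwoShaCountCMInertRamifiedAtTwo
import Summits.BirchSwinnertonDyer.BirchSwinnertonDyer.Theorems.CMKolyvaginAtInertTwoShaCountRankFiniteAtTwo
import HarnessLib

/-!
# Route `CMKolyvaginAtInertTwo`, crux `CMKolyvaginExactAtInertTwo` (stmt-BirchSwinnertonDyer-24277):
# THE COUNT IDENTITY, IX — for the CRUX'S OWN BINDERS (prime `|d_K|`), modulo the route's four
# published inputs (Gross–Zagier, GZK, modularity, Milne)

Seat `bsd-line-cmk2-p1` g15 (cell `bsd-print-cf2`); helper (`--supports stmt-BirchSwinnertonDyer-24277`).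
THEOREMS ONLY: no definition, no named fact, no `sorry`; the route's support items `GrossZagierAllLevels`
(24148), `MultPublishedInputsAtTwo` = GZK (19921), `EntireLFunctionRat` (19273), `MilneAnyModel` (24149)
are HYPOTHESES — the `…OfFacts` shape of 22837/24154 —; no item is closed; BSD is not proved by this.

Files IV–VIII assembled: for the binders of `CMKolyvaginExactAtInertTwo` (`W` globally minimal with
CM, `2` inert in `F`, `ρ̄_{E,2}` onto; `K` imaginary quadratic, `d_K` odd, Heegner hypothesis;
`Dt`, `d₁` with `y_K = P(1)` of infinite order) PLUS `|d_K|` prime, the `2`-primary part of `Ш(E_K)`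
is the product of those of `E` and of its twist: the globally minimal twist model with `|u| = 1`
exists (VI), total rank one and finiteness come from the Heegner datum (VIII), `CMInert W |d_K|`
from reciprocity (VII), and `Ш` does not depend on the model
(`card_primaryComponent_sha_variableChange`). The binders `d_K ≠ −3`, the two `¬IsSquare`
conditions, `Odd ∏c_ℓ`, the `M₀`-clauses and the Kolyvagin-prime data of 24277 are not used.

* `card_primaryComponent_sha_two_baseChange_eq_mul_of_heegnerData_of_facts` — **`Ш(E_K)` finite and
  `#Ш(E_K)[2^∞] = #Ш(E/ℚ)[2^∞] · #Ш(E^{(d_K)}/ℚ)[2^∞]`** (the twist as `W.quadraticTwist d_K`);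
* `card_primaryComponent_sha_two_baseChange_eq_pow_of_pair_of_facts` — **THE REDUCTION of the crux's
  conclusion to the pair over `ℚ`**: if `#Ш(E/ℚ)[2^∞] · #Ш(E^{(d_K)}/ℚ)[2^∞] = 2^{2M₀}` then
  `Nat.card (Ш(E_K)(2)) = 2^{2M₀}` — the exact shape the `p = 2` pair telescope (≤) and McCallum's
  Prop. 5.2 at `2` (≥) are to deliver (KERNEL-STATUS §14.2).

With the pair telescope (`…PairTelescopeBoundOfInjectiveAtTwo`, g14) and its pending T2/T3 inputs
this is the bridge to the crux's `Nat.card (Ш(E_K)(2)) = 2^{2M₀}` (KERNEL-STATUS §14.2).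
References: Milne 1972 §1; Gross–Zagier 1986; Gross 1991 §§1–2; Kramer 1981 Prop. 3.
-/

-- single-conjunct summit: `Summit.BirchSwinnertonDyer.BirchSwinnertonDyer.…` repeats the name by design
set_option linter.dupNamespace false
set_option autoImplicit false

noncomputable section

open scoped Classical

open WeierstrassCurve NumberField Literature.NumberTheory.EllipticCurves
  Literature.NumberTheory.EllipticCurves.ModularForms Literature.NumberTheory.EllipticCurves.Rank1Residual
  Literature.NumberTheory.QuadraticFields

namespace Summit.BirchSwinnertonDyer.BirchSwinnertonDyer.Theorems.ShaCountTwo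

/-- **THE COUNT IDENTITY FOR THE CRUX'S BINDERS, PRIME `|d_K|`, MODULO THE ROUTE'S PUBLISHED INPUTS.**
Assume Gross–Zagier at all levels (`hGZ`), GZK (`hGZK`), modularity (`hmod`) and Milne's
Weil-restriction theorem (`hMilneC`). Let `W/ℚ` be globally minimal with CM, `2` inert in the CM
field, `ρ̄_{E,2}` onto; `K` imaginary quadratic with `d_K` odd and `|d_K|` PRIME, satisfying the Heegner
hypothesis for the conductor; `Dt` a parametrisation datum and `d₁` Kolyvagin–Heegner data of
conductor `1` with `P(1)` of infinite order. THEN `Ш(E_K)` is finite and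
**`#Ш(E_K)[2^∞] = #Ш(E/ℚ)[2^∞] · #Ш(E^{(d_K)}/ℚ)[2^∞]`**.
[cite: Milne1972ArithmeticAV, §1 Thm. 1 and §2 (through DokchitserDokchitserAnnals2010, §2.1, proof of Thm. 2.3)]
[cite: GrossZagier1986, Thm. I.(6.3) with V.§2] [cite: Kramer1981, Prop. 3] -/
theorem card_primaryComponent_sha_two_baseChange_eq_mul_of_heegnerData_of_facts
    (hGZ : ∀ (N : ℕ) [NeZero N] (W : WeierstrassCurve ℚ) (K : Type) [Field K] [NumberField K],
      gross_zagier N W K)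
    (hGZK : rank_eq_analyticRank_of_analyticRank_le_one) (hmod : hasEntireLFunction_rat)
    (hMilneC : Milne1972.bsdQuotient_baseChange_quadratic_anyModel)
    (W : WeierstrassCurve ℚ) [W.IsElliptic] [W.IsGloballyMinimal] [NeZero (W.conductorNorm ℤ)]
    (hCM : W.HasCM) (hin : CMInert W 2) (hsurj : W.HasSurjectiveModNGaloisRep 2)
    (K : Type) [Field K] [NumberField K] (hK : IsImaginaryQuadratic K)
    (hodd : Odd (NumberField.discr K)) (hH : SatisfiesHeegnerHypothesis (W.conductorNorm ℤ) K)
    (hq : (NumberField.discr K).natAbs.Prime)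
    (Dt : ModularParametrizationData W (W.conductorNorm ℤ)) (β : ℤ) (ι : K →+* ℂ)
    (d₁ : KolyvaginHeegnerData Dt β ι 1) (hy : ¬ IsOfFinAddOrder d₁.derivedPoint) :
    Finite (W.baseChange K).sha ∧
      Nat.card (AddCommGroup.primaryComponent (W.baseChange K).sha 2) =
        Nat.card (AddCommGroup.primaryComponent W.sha 2) *
          Nat.card (AddCommGroup.primaryComponent
            (W.quadraticTwist (NumberField.discr K : ℚ)).sha 2) := by
  -- the globally minimal twist model with unit scaling
  obtain ⟨Wd, Cd, hWd, hu, hEd, hmin⟩ :=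
    exists_isGloballyMinimal_twist_of_prime_discr W K hK hodd hH hq
  haveI : Wd.IsElliptic := hEd
  haveI : Wd.IsGloballyMinimal := hmin
  -- total rank one and finiteness from the Heegner datum
  obtain ⟨hr, hfinW, hfinD⟩ := rank_add_eq_one_and_finite_sha_of_heegnerData_of_facts hGZ hGZK hmod W K
    hK hH Dt β ι d₁ hy Wd ⟨Cd, hWd⟩
  haveI : Finite W.sha := hfinW
  haveI : Finite Wd.sha := hfinD
  obtain ⟨hfinK, hcount⟩ := card_primaryComponent_sha_two_baseChange_eq_mul_of_heegner_prime_of_milne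
    hMilneC W hCM hin hsurj K hK hodd hH hq Wd Cd hWd hu hr
  refine ⟨hfinK, ?_⟩
  rw [hcount, ← hWd, card_primaryComponent_sha_variableChange]

/-- **REDUCTION OF THE CRUX'S CONCLUSION TO THE PAIR OVER `ℚ`** (prime `|d_K|`, modulo the route's
published inputs). Under the hypotheses of
`card_primaryComponent_sha_two_baseChange_eq_mul_of_heegnerData_of_facts`, if the `2`-primary parts of
`Ш(E/ℚ)` and `Ш(E^{(d_K)}/ℚ)` multiply to `2^{2M₀}` then `#Ш(E_K)[2^∞] = 2^{2M₀}` — the conclusion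
of `CMKolyvaginExactAtInertTwo` in its own currency `Nat.card (primaryComponent (W.baseChange K).sha 2)`.
So 24277 (prime `|d_K|`) follows from the route's facts and ONE statement about the pair
`(E, E^{(d_K)})` over `ℚ`: `#Ш(E)[2^∞]·#Ш(E^{(d_K)})[2^∞] = 2^{2M₀}` under the crux's binders — "≤" is
the target of the pair telescope (`…PairTelescopeBoundOfInjectiveAtTwo`), "≥" of McCallum Prop. 5.2
at `2`. [cite: McCallumLMS1991, §5 Thm. 5.4, Cor. 5.6] [cite: Milne1972ArithmeticAV, §1 Thm. 1] -/
theorem card_primaryComponent_sha_two_baseChange_eq_pow_of_pair_of_facts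
    (hGZ : ∀ (N : ℕ) [NeZero N] (W : WeierstrassCurve ℚ) (K : Type) [Field K] [NumberField K],
      gross_zagier N W K)
    (hGZK : rank_eq_analyticRank_of_analyticRank_le_one) (hmod : hasEntireLFunction_rat)
    (hMilneC : Milne1972.bsdQuotient_baseChange_quadratic_anyModel)
    (W : WeierstrassCurve ℚ) [W.IsElliptic] [W.IsGloballyMinimal] [NeZero (W.conductorNorm ℤ)]
    (hCM : W.HasCM) (hin : CMInert W 2) (hsurj : W.HasSurjectiveModNGaloisRep 2)
    (K : Type) [Field K] [NumberField K] (hK : IsImaginaryQuadratic K)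
    (hodd : Odd (NumberField.discr K)) (hH : SatisfiesHeegnerHypothesis (W.conductorNorm ℤ) K)
    (hq : (NumberField.discr K).natAbs.Prime)
    (Dt : ModularParametrizationData W (W.conductorNorm ℤ)) (β : ℤ) (ι : K →+* ℂ)
    (d₁ : KolyvaginHeegnerData Dt β ι 1) (hy : ¬ IsOfFinAddOrder d₁.derivedPoint) {M₀ : ℕ}
    (hpair : Nat.card (AddCommGroup.primaryComponent W.sha 2) *
      Nat.card (AddCommGroup.primaryComponent (W.quadraticTwist (NumberField.discr K : ℚ)).sha 2) =
        2 ^ (2 * M₀)) :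
    Nat.card (AddCommGroup.primaryComponent (W.baseChange K).sha 2) = 2 ^ (2 * M₀) := by
  rw [(card_primaryComponent_sha_two_baseChange_eq_mul_of_heegnerData_of_facts hGZ hGZK hmod hMilneC W
    hCM hin hsurj K hK hodd hH hq Dt β ι d₁ hy).2, hpair]

end Summit.BirchSwinnertonDyer.BirchSwinnertonDyer.Theorems.ShaCountTwo

end
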